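import Literature.Probability.Percolation.QuadCrossingContinuity
import Literature.Probability.Percolation.QuadCrossingSpaceZ2
import HarnessLib

/-!
# Schramm–Smirnov's Lemma 6.1: the size parameter `d(Q)` and two reductions of the named fact

Topic `Probability/Percolation`; first proofs file next to `QuadCrossingContinuity.lean`, whose one
named fact `SchrammSmirnov2011_lemma_6_1` (O. Schramm, S. Smirnov, *On the scaling limits of
planar percolation*, Ann. Probab. 39 (2011), arXiv:1101.5820, §6 Lemma 6.1: crossing events of
critical percolation are stable under `δ`-perturbations of a quad, uniformly in the mesh) is the
target.  The printed proof ("a simple application of the RSW estimate (1.1) and the 'lowest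
crossing' concept", pp. 22–23 of the arXiv version) has a soft outer layer and a hard percolation
core; this file proves the soft layer once and for all.

* `Quad.sideDist` / `Quad.sizeParam` API: the defining set of `d_j(Q)` is nonempty
  (`Quad.exists_path_side_to_side`) and bounded below by the positive distance between the two
  opposite (disjoint, compact) sides, so **`0 < d_j(Q)`** and **`0 < d(Q)`**
  (`Quad.sideDist_pos`, `Quad.sizeParam_pos`); `Quad.sideDist_le` (every admissible path bounds
  `d_j` from above).
* **Envelope reduction** `SchrammSmirnov2011_lemma_6_1_of_bound`: the fact follows from ANY bound
  of the form `μ_η(⊞_Q Δ ⊞_{Q'}) ≤ F(δ / d(Q))` valid for `0 < η < δ ≤ c·d(Q)` under conditions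
  (1)/(2)/(3), with `F → 0` at `0⁺` (the printed `Δ_c(δ, d)` is then
  `|F(δ/d)| + δ/d + 2δ/(c d)`: positive, tending to `0` for fixed `d`, and `≥ 2 > μ_η(…)` in the
  trivial range `δ > c d` — "recall our convention that `Δ(r, R) = 1` for `r ≥ R`", p. 22).
* **Law-to-configuration reduction** `real_squareCrossingLaw_symmDiff_le`:
  `μ_η(⊞_Q Δ ⊞_{Q'}) ≤ P_{1/2}{ω : exactly one of Q, Q' lies in ω_{η√2}}` for the tree's laws
  (`squareCrossingLaw D η = z2QuadLaw D (η√2)`, a push-forward of `P_{1/2}`; no measurability of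
  `ω ↦ ω_δ` is needed: a non-a.e.-measurable push-forward is `0`).

No named fact is introduced; nothing here is specific to the percolation estimates, which are the
business of the later proofs files (RSW input: `annulusOpenCrossing_half_le_holds`).

## References

* O. Schramm, S. Smirnov, Ann. Probab. 39 (2011) 1768–1814, arXiv:1101.5820, §6 Lemma 6.1 and
  its proof, pp. 22–23; §1.3 (`⊞_Q`, `μ_η`). [SchrammSmirnov2011]
-/

noncomputable section

open Set Filter MeasureTheory Metric
open scoped Topology unitInterval

namespace Literature.Probability.Percolation

namespace QuadCrossing

namespace Quad

variable {D : Set ℂ}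

/-! ### The sides of a quad: compactness, disjointness of opposite sides -/

/-- Each side `∂ₖQ` is compact (image of a closed edge of the square). [cite: SchrammSmirnov2011, §1.3] -/
theorem isCompact_side (Q : Quad D) (k : Fin 4) : IsCompact (Q.side k) := by
  have h1 : IsClosed {z : I × I | z.1 = 0} := isClosed_eq continuous_fst continuous_const
  have h2 : IsClosed {z : I × I | z.2 = 0} := isClosed_eq continuous_snd continuous_const
  have h3 : IsClosed {z : I × I | z.1 = 1} := isClosed_eq continuous_fst continuous_const
  have h4 : IsClosed {z : I × I | z.2 = 1} := isClosed_eq continuous_snd continuous_const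
  match k with
  | 0 => exact h1.isCompact.image Q.continuous_toFun
  | 1 => exact h2.isCompact.image Q.continuous_toFun
  | 2 => exact h3.isCompact.image Q.continuous_toFun
  | 3 => exact h4.isCompact.image Q.continuous_toFun

/-- Images under the (injective) quad of two disjoint subsets of the square are disjoint. [folklore] -/
theorem disjoint_image_of_forall_ne (Q : Quad D) {p q : I × I → Prop}
    (h : ∀ z w, p z → q w → z ≠ w) : Disjoint (Q '' {z | p z}) (Q '' {z | q z}) := by
  rw [Set.disjoint_iff]
  rintro _ ⟨⟨z, hz, rfl⟩, ⟨w, hw, hzw⟩⟩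
  exact h z w hz hw (Q.injective_toFun hzw).symm

/-- **Opposite sides of a quad are disjoint**: `∂ₖQ ∩ ∂_{k+2}Q = ∅` (the quad is injective and
the opposite edges of the square are disjoint). [cite: SchrammSmirnov2011, §1.3] -/
theorem disjoint_side_side_add_two (Q : Quad D) (k : Fin 4) :
    Disjoint (Q.side k) (Q.side (k + 2)) := by
  match k with
  | 0 =>
    show Disjoint (Q '' {z : I × I | z.1 = 0}) (Q '' {z : I × I | z.1 = 1})
    exact Q.disjoint_image_of_forall_ne fun z w hz hw hzw => by
      have : (z.1 : ℝ) = w.1 := by rw [hzw]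
      rw [hz, hw] at this
      norm_num at this
  | 1 =>
    show Disjoint (Q '' {z : I × I | z.2 = 0}) (Q '' {z : I × I | z.2 = 1})
    exact Q.disjoint_image_of_forall_ne fun z w hz hw hzw => by
      have : (z.2 : ℝ) = w.2 := by rw [hzw]
      rw [hz, hw] at this
      norm_num at this
  | 2 =>
    show Disjoint (Q '' {z : I × I | z.1 = 1}) (Q '' {z : I × I | z.1 = 0})
    exact Q.disjoint_image_of_forall_ne fun z w hz hw hzw => by
      have : (z.1 : ℝ) = w.1 := by rw [hzw]
      rw [hz, hw] at this
      norm_num at this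
  | 3 =>
    show Disjoint (Q '' {z : I × I | z.2 = 1}) (Q '' {z : I × I | z.2 = 0})
    exact Q.disjoint_image_of_forall_ne fun z w hz hw hzw => by
      have : (z.2 : ℝ) = w.2 := by rw [hzw]
      rw [hz, hw] at this
      norm_num at this

/-- Opposite sides of a quad are at positive distance: some `ε > 0` bounds `dist x y` from below
for `x ∈ ∂ₖQ`, `y ∈ ∂_{k+2}Q` (disjoint compact sets). [folklore] -/
theorem exists_pos_le_dist_side_side_add_two (Q : Quad D) (k : Fin 4) :
    ∃ ε : ℝ, 0 < ε ∧ ∀ x ∈ Q.side k, ∀ y ∈ Q.side (k + 2), ε ≤ dist x y := by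
  obtain ⟨ε, hε, hdisj⟩ := (Q.disjoint_side_side_add_two k).exists_cthickenings
    (Q.isCompact_side k) (Q.isCompact_side (k + 2)).isClosed
  refine ⟨ε, hε, fun x hx y hy => ?_⟩
  by_contra hlt
  push Not at hlt
  exact Set.disjoint_left.1 hdisj
    (mem_cthickening_of_dist_le y x ε _ hx (by rw [dist_comm]; exact hlt.le))
    (self_subset_cthickening _ hy)

/-! ### `d_j(Q)`: the defining set is nonempty and bounded below by a positive number -/

/-- **The defining set of `d_j(Q)` is nonempty**: there is a path in `[Q]` from `∂ⱼQ` to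
`∂_{j+2}Q` (a straight edge of the square, pushed forward by `Q`: `t ↦ Q(t, 0)` joins
`Q(0,0) ∈ ∂₀Q` to `Q(1,0) ∈ ∂₂Q`, `t ↦ Q(0, t)` joins `Q(0,0) ∈ ∂₁Q` to `Q(0,1) ∈ ∂₃Q`, and their
reverses serve `j = 2, 3`). [cite: SchrammSmirnov2011, Lemma 6.1] -/
theorem exists_path_side_to_side (Q : Quad D) (j : Fin 4) :
    ∃ x ∈ Q.side j, ∃ y ∈ Q.side (j + 2), ∃ γ : Path x y, range γ ⊆ Q.carrier := by
  -- the two straight paths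
  let γb : Path (Q (0, 0)) (Q (1, 0)) :=
    { toFun := fun t => Q (t, 0)
      continuous_toFun := Q.continuous_toFun.comp (continuous_id.prodMk continuous_const)
      source' := rfl
      target' := rfl }
  let γl : Path (Q (0, 0)) (Q (0, 1)) :=
    { toFun := fun t => Q (0, t)
      continuous_toFun := Q.continuous_toFun.comp (continuous_const.prodMk continuous_id)
      source' := rfl
      target' := rfl }
  have hb : range γb ⊆ Q.carrier := by
    rintro _ ⟨t, rfl⟩
    exact ⟨(t, 0), rfl⟩
  have hl : range γl ⊆ Q.carrier := by
    rintro _ ⟨t, rfl⟩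
    exact ⟨(0, t), rfl⟩
  match j with
  | 0 => exact ⟨Q (0, 0), ⟨(0, 0), rfl, rfl⟩, Q (1, 0), ⟨(1, 0), rfl, rfl⟩, γb, hb⟩
  | 1 => exact ⟨Q (0, 0), ⟨(0, 0), rfl, rfl⟩, Q (0, 1), ⟨(0, 1), rfl, rfl⟩, γl, hl⟩
  | 2 =>
    refine ⟨Q (1, 0), ⟨(1, 0), rfl, rfl⟩, Q (0, 0), ⟨(0, 0), rfl, rfl⟩, γb.symm, ?_⟩
    rw [Path.symm_range]
    exact hb
  | 3 =>
    refine ⟨Q (0, 1), ⟨(0, 1), rfl, rfl⟩, Q (0, 0), ⟨(0, 0), rfl, rfl⟩, γl.symm, ?_⟩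
    rw [Path.symm_range]
    exact hl

/-- The defining set of `d_j(Q)`, as a named set (the `sInf` in `Quad.sideDist` is over it).
[cite: SchrammSmirnov2011, Lemma 6.1] -/
theorem sideDist_eq (Q : Quad D) (j : Fin 4) : Q.sideDist j =
    sInf {r : ℝ | ∃ x ∈ Q.side j, ∃ y ∈ Q.side (j + 2), ∃ γ : Path x y,
      range γ ⊆ Q.carrier ∧ Metric.diam (range γ) = r} := rfl

/-- The defining set of `d_j(Q)` is nonempty. [cite: SchrammSmirnov2011, Lemma 6.1] -/
theorem nonempty_sideDistSet (Q : Quad D) (j : Fin 4) :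
    {r : ℝ | ∃ x ∈ Q.side j, ∃ y ∈ Q.side (j + 2), ∃ γ : Path x y,
      range γ ⊆ Q.carrier ∧ Metric.diam (range γ) = r}.Nonempty := by
  obtain ⟨x, hx, y, hy, γ, hγ⟩ := Q.exists_path_side_to_side j
  exact ⟨_, x, hx, y, hy, γ, hγ, rfl⟩

/-- **`d_j(Q) ≤ diam γ`** for every path `γ ⊆ [Q]` from `∂ⱼQ` to `∂_{j+2}Q`.
[cite: SchrammSmirnov2011, Lemma 6.1] -/
theorem sideDist_le {Q : Quad D} {j : Fin 4} {x y : ℂ} (hx : x ∈ Q.side j)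
    (hy : y ∈ Q.side (j + 2)) (γ : Path x y) (hγ : range γ ⊆ Q.carrier) :
    Q.sideDist j ≤ Metric.diam (range γ) :=
  csInf_le ⟨0, by rintro r ⟨x, -, y, -, γ, -, rfl⟩; exact Metric.diam_nonneg⟩
    ⟨x, hx, y, hy, γ, hγ, rfl⟩

/-- `0 ≤ d_j(Q)`. [cite: SchrammSmirnov2011, Lemma 6.1] -/
theorem sideDist_nonneg (Q : Quad D) (j : Fin 4) : 0 ≤ Q.sideDist j :=
  Real.sInf_nonneg (by rintro r ⟨x, -, y, -, γ, -, rfl⟩; exact Metric.diam_nonneg)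

/-- A lower bound for `d_j(Q)`: if every path in `[Q]` from `∂ⱼQ` to `∂_{j+2}Q` has diameter
`≥ ε`, then `ε ≤ d_j(Q)`. [cite: SchrammSmirnov2011, Lemma 6.1] -/
theorem le_sideDist {Q : Quad D} {j : Fin 4} {ε : ℝ}
    (h : ∀ x ∈ Q.side j, ∀ y ∈ Q.side (j + 2), ∀ γ : Path x y, range γ ⊆ Q.carrier →
      ε ≤ Metric.diam (range γ)) : ε ≤ Q.sideDist j :=
  le_csInf (Q.nonempty_sideDistSet j) (by
    rintro r ⟨x, hx, y, hy, γ, hγ, rfl⟩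
    exact h x hx y hy γ hγ)

/-- The diameter of a path from `∂ⱼQ` to `∂_{j+2}Q` is at least the distance between its
endpoints, hence at least the (positive) distance between the two opposite sides. [folklore] -/
theorem dist_le_diam_range_path {x y : ℂ} (γ : Path x y) : dist x y ≤ Metric.diam (range γ) :=
  dist_le_diam_of_mem (isCompact_range γ.continuous).isBounded ⟨0, γ.source⟩ ⟨1, γ.target⟩

/-- **`0 < d_j(Q)`**: opposite sides are disjoint compact sets, so every path joining them has
diameter at least their positive distance. [cite: SchrammSmirnov2011, Lemma 6.1] -/
theorem sideDist_pos (Q : Quad D) (j : Fin 4) : 0 < Q.sideDist j := by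
  obtain ⟨ε, hε, hdist⟩ := Q.exists_pos_le_dist_side_side_add_two j
  exact hε.trans_le (le_sideDist fun x hx y hy γ _ =>
    (hdist x hx y hy).trans (dist_le_diam_range_path γ))

/-- **`0 < d(Q) = max{d₀(Q), d₁(Q)}`**. [cite: SchrammSmirnov2011, Lemma 6.1] -/
theorem sizeParam_pos (Q : Quad D) : 0 < Q.sizeParam :=
  lt_max_of_lt_left (Q.sideDist_pos 0)

/-- `d₀(Q) ≤ d(Q)`. [cite: SchrammSmirnov2011, Lemma 6.1] -/
theorem sideDist_zero_le_sizeParam (Q : Quad D) : Q.sideDist 0 ≤ Q.sizeParam := le_max_left _ _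

/-- `d₁(Q) ≤ d(Q)`. [cite: SchrammSmirnov2011, Lemma 6.1] -/
theorem sideDist_one_le_sizeParam (Q : Quad D) : Q.sideDist 1 ≤ Q.sizeParam := le_max_right _ _

end Quad

/-! ### The laws are sub-probability measures; law-to-configuration reduction -/

variable {D : Set ℂ}

/-- `μ_η(A) ≤ 1`: the law `squareCrossingLaw D η` is the push-forward of the probability measure
`P_{1/2}`, hence a probability measure or (if the encoding were not a.e.-measurable) zero.
[cite: SchrammSmirnov2011, §1.3] -/
theorem real_squareCrossingLaw_le_one (D : Set ℂ) (η : ℝ) (A : Set (QuadConfig D)) :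
    (squareCrossingLaw D η : Measure (QuadConfig D)).real A ≤ 1 := by
  rw [squareCrossingLaw_eq_z2QuadLaw, toMeasure_z2QuadLaw]
  exact measureReal_le_one

/-- **Law-to-configuration reduction.** For the tree's laws of critical bond percolation,
`μ_η(⊞_Q Δ ⊞_{Q'}) ≤ P_{1/2}({ω : Q ∈ ω_{η√2}} Δ {ω : Q' ∈ ω_{η√2}})`, where `ω_δ = z2QuadConfig D δ ω`
is the (closed-up) set of quads crossed inside the drawn open edges of `δℤ²`: equality when
`ω ↦ ω_δ` is a.e.-measurable (it is, for `D` open: `measurable_z2QuadConfig`), and the left side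
vanishes otherwise. [cite: SchrammSmirnov2011, §1.3 and Lemma 6.1] -/
theorem real_squareCrossingLaw_symmDiff_le (D : Set ℂ) (η : ℝ) (Q Q' : Quad D) :
    (squareCrossingLaw D η : Measure (QuadConfig D)).real
        (symmDiff (QuadConfig.crossedEvent Q) (QuadConfig.crossedEvent Q')) ≤
      (bondPercolation (LatticeModels.zdGraph 2) half).real
        (symmDiff {ω | Q ∈ z2QuadConfig D (η * Real.sqrt 2) ω}
          {ω | Q' ∈ z2QuadConfig D (η * Real.sqrt 2) ω}) := by
  rw [squareCrossingLaw_eq_z2QuadLaw, toMeasure_z2QuadLaw]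
  set f := z2QuadConfig D (η * Real.sqrt 2) with hf
  have hs : MeasurableSet (symmDiff (QuadConfig.crossedEvent Q) (QuadConfig.crossedEvent Q')) :=
    (QuadConfig.measurableSet_crossedEvent Q).symmDiff (QuadConfig.measurableSet_crossedEvent Q')
  have hpre : f ⁻¹' symmDiff (QuadConfig.crossedEvent Q) (QuadConfig.crossedEvent Q') =
      symmDiff {ω | Q ∈ f ω} {ω | Q' ∈ f ω} := rfl
  by_cases hfm : AEMeasurable f (bondPercolation (LatticeModels.zdGraph 2) half)
  · rw [measureReal_def, Measure.map_apply_of_aemeasurable hfm hs, hpre, ← measureReal_def]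
  · rw [Measure.map_of_not_aemeasurable hfm]
    simp only [Measure.real, Measure.coe_zero, Pi.zero_apply, ENNReal.toReal_zero]
    exact measureReal_nonneg

/-! ### The envelope reduction: `Δ_c` from any scale-free bound -/

/-- **Envelope reduction for Lemma 6.1.** Suppose that for some `c > 0` and some `F : ℝ → ℝ` with
`F → 0` as its argument tends to `0⁺`, the estimate `μ_η(⊞_Q Δ ⊞_{Q'}) ≤ F(δ / d(Q))` holds for all
`D`, all quads `Q, Q'` of `D`, all `0 < δ ≤ c · d(Q)` satisfying one of the conditions (1), (2),
(3), and all meshes `0 < η < δ`.  Then `SchrammSmirnov2011_lemma_6_1` holds, with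
`Δ_c(δ, d) := |F(δ/d)| + δ/d + 2δ/(c d)` (positive for `δ, d > 0`; `→ 0` as `δ → 0⁺` for fixed
`d > 0`; and `> 2 ≥ 1 ≥ μ_η(…)` in the complementary range `δ > c d`, cf. "our convention that
`Δ(r, R) = 1` for `r ≥ R`", p. 22).  This isolates the soft part of the printed statement ("there
exist a positive function `Δ_c(δ, d)` such that `lim_{δ→0} Δ_c(δ, d) = 0` for any fixed `d`").
[cite: SchrammSmirnov2011, Lemma 6.1] -/
theorem SchrammSmirnov2011_lemma_6_1_of_bound {c : ℝ} (hc : 0 < c) (F : ℝ → ℝ)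
    (hF : Tendsto F (𝓝[>] 0) (𝓝 0))
    (hbound : ∀ (D : Set ℂ) (Q Q' : Quad D) (δ : ℝ), 0 < δ → δ ≤ c * Q.sizeParam →
      (Q.IsPerturbationOne Q' δ ∨ Q.IsPerturbationTwo Q' δ ∨ Q.IsPerturbationThree Q' δ) →
        ∀ η : ℝ, 0 < η → η < δ →
          (squareCrossingLaw D η : Measure (QuadConfig D)).real
              (symmDiff (QuadConfig.crossedEvent Q) (QuadConfig.crossedEvent Q')) ≤
            F (δ / Q.sizeParam)) :
    SchrammSmirnov2011_lemma_6_1 := by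
  refine ⟨fun δ d => |F (δ / d)| + δ / d + 2 * δ / (c * d), ?_, ?_, ?_⟩
  · -- positivity
    intro δ d hδ hd
    have h1 : 0 ≤ |F (δ / d)| := abs_nonneg _
    have h2 : 0 < δ / d := div_pos hδ hd
    have h3 : 0 ≤ 2 * δ / (c * d) := by positivity
    linarith
  · -- the limit `δ → 0⁺` for fixed `d > 0`
    intro d hd
    have hdiv : Tendsto (fun δ : ℝ => δ / d) (𝓝[>] 0) (𝓝[>] 0) := by
      refine tendsto_nhdsWithin_iff.2 ⟨?_, ?_⟩
      · have : Tendsto (fun δ : ℝ => δ / d) (𝓝 0) (𝓝 (0 / d)) :=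
          (continuous_id.div_const d).tendsto 0
        rw [zero_div] at this
        exact this.mono_left nhdsWithin_le_nhds
      · filter_upwards [self_mem_nhdsWithin] with δ hδ
        exact div_pos hδ hd
    have hA : Tendsto (fun δ : ℝ => |F (δ / d)|) (𝓝[>] 0) (𝓝 0) := by
      simpa using (hF.comp hdiv).abs
    have hB : Tendsto (fun δ : ℝ => δ / d) (𝓝[>] 0) (𝓝 0) :=
      (tendsto_nhdsWithin_iff.1 hdiv).1
    have hC : Tendsto (fun δ : ℝ => 2 * δ / (c * d)) (𝓝[>] 0) (𝓝 0) := by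
      have : Tendsto (fun δ : ℝ => 2 * δ / (c * d)) (𝓝 0) (𝓝 (2 * 0 / (c * d))) :=
        ((continuous_const.mul continuous_id).div_const (c * d)).tendsto 0
      rw [mul_zero, zero_div] at this
      exact this.mono_left nhdsWithin_le_nhds
    simpa using (hA.add hB).add hC
  · -- the estimate
    intro D Q Q' δ hδ hδd hcond η hη hηδ
    have hd : 0 < Q.sizeParam := Q.sizeParam_pos
    set d := Q.sizeParam with hd_def
    have h2 : 0 < δ / d := div_pos hδ hd
    have h3 : 0 ≤ 2 * δ / (c * d) := by positivity
    by_cases hcase : δ ≤ c * d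
    · have := hbound D Q Q' δ hδ hcase hcond η hη hηδ
      have habs : F (δ / d) ≤ |F (δ / d)| := le_abs_self _
      linarith
    · push Not at hcase
      have hP := real_squareCrossingLaw_le_one D η
        (symmDiff (QuadConfig.crossedEvent Q) (QuadConfig.crossedEvent Q'))
      have hbig : 2 < 2 * δ / (c * d) := by
        rw [lt_div_iff₀ (mul_pos hc hd)]
        nlinarith
      have h1 : 0 ≤ |F (δ / d)| := abs_nonneg _
      linarith

end QuadCrossing

end Literature.Probability.Percolation
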